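/-
Copyright (c) 2026. All rights reserved.
Released under Apache 2.0 license as described in the file LICENSE.
-/
import Literature.Geometry.Kaehler.ComplexTorusQuaternionXSixEichlerOptimalEmbeddings
import Literature.Geometry.Kaehler.ComplexTorusQuaternionXSixSpecialCyclesClassCount
import Mathlib.NumberTheory.LegendreSymbol.Basic
import Mathlib.NumberTheory.LegendreSymbol.ZModChar
import HarnessLib

/-!
# Eichler's class-number formula for `|L(t)/O₆^×|` in closed form:
# `|L(t)/O₆^×| = Σ_{f ∣ F} h(B_f)·m₂(B_f)·m₃(B_f) = (1 − χ₈(d_K))(1 − (d_K∕3)) · Σ_{c ∣ F, (c,6)=1} h(c²·d_K)`,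
# `4t = F²·(−d_K)`; and `P(m) = h(D_m)·[4 ∤ m](1 − χ₈(D_m))·[9 ∤ m](1 − (D_m∕3))`

Sixth file of the Eichler-count plan for the X₆ special cycles. `…XSixEichlerOptimalEmbeddings` proved EICHLER'S
FORMULA `#{[J] ∈ ThroughClass O₆ γ : O_L(J) ∩ ℚ(γ) = B_f} = h(B_f)·m₂(B_f)·m₃(B_f)` for every order
`B_f = ℤ[σ_f] ∋ γ` (`f ∈ ellipticConductors t n`, i.e. `f ∣ F`, `F = Brandt.conductor t n` the conductor of `ℤ[γ]`,
`B_F = O_K` the maximal order) and `…XSixIdealClassesSpecialVectors` proved `#(ThroughClass O₆ γ) = |L(t)/O₆^×|`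
for a pure `γ` of norm `t`. Summing Eichler's formula over the orders through `γ` (they are exactly the `B_f`,
`GammaHyp.exists_eq_ordOf`, pairwise distinct, `GammaHyp.ordOf_injective`) gives the number of `O₆^×`-classes of
special vectors of norm `t` — the index set of KRY (3.4.13) — in closed form:

* §1 **`card_unit_classes_eq_sum_conductors`**: for every `t > 0`,
  `|L(t)/O₆^×| = Σ_{f ∈ ellipticConductors 0 t} h(t_f² − 4n_f) · m₂(B_f) · m₃(B_f)` (Vignéras III.5.14
  `Σ_B h(B) ∏_p m_p(B)`; both sides `0` when no pure element of norm `t` exists in `B`).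
* §2 **`card_unit_classes_eq_delta_mul_sum_classNumber`** (KRY (3.4.6) shape): with `F = conductor 0 t`,
  `d_K = t_F² − 4n_F` (so `F²·d_K = −4t`, `conductor_sq_mul_disc`) and `c = F/f`,
  `h(B_f) = h(c²·d_K)` and `m_p(B_f) = [p ∤ c]·m_p(O_K)` (`m_p(O_K) = 2 − ρ_p(t_F, n_F) = 1 − χ_{d_K}(p)`), hence
  `|L(t)/O₆^×| = m₂(O_K)·m₃(O_K) · Σ_{c ∣ F, (c, 6) = 1} h(c²·d_K)` — KRY's `δ(d; D(B)) · Σ_{c ∣ n, (c, D(B)) = 1} h(c²d)`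
  with `4t = n²d`, `n = F`, `d = −d_K`, `D(B) = 6`.
* §3 the dictionary: **`rho_two_eq_one_add_χ₈`** (`ρ₂(t, n) = 1 + χ₈(t² − 4n)`), **`rho_three_eq_one_add_legendreSym`**
  (`ρ₃(t, n) = 1 + (t² − 4n ∕ 3)`), hence `m₂(O_K) = 1 − χ₈(d_K)`, `m₃(O_K) = 1 − (d_K∕3)` and
  **`card_unit_classes_eq_kronecker_mul_sum_classNumber`**:
  `|L(t)/O₆^×| = (1 − χ₈(d_K))·(1 − legendreSym 3 d_K)·Σ_{c ∣ F, (c,6)=1} h(c²·d_K)` — the general statement behind the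
  twelve tabulated identities `eichler_classNumber_formula_<t>` of `…XSixSpecialCyclesEichlerClassNumbers` (same
  dictionary `χ_d(2) = ZMod.χ₈ (−d)`, `χ_d(3) = legendreSym 3 (−d)`).
* §4 **`card_primitive_classes_closed_form`**: `P(m) = h(D_m)·[4 ∤ m]·(1 − χ₈(D_m))·[9 ∤ m]·(1 − (D_m∕3))`,
  `D_m = disc S_m` (`−m` if `m ≡ 3 (mod 4)`, else `−4m`), and `closed_form_values` / `card_primitive_one_via_eichler`:
  the closed form reproduces the enumerated `P(1) = P(3) = 2`, `P(25) = P(75) = 4` (`P(100) = 0` by `4 ∣ 100`).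

## Sources

* M. Eichler, *Zur Zahlentheorie der Quaternionen-Algebren*, J. reine angew. Math. 195 (1955), Satz 5.
  [cite: Eichler1955, Satz 5]
* M.-F. Vignéras, *Arithmétique des algèbres de quaternions*, LNM 800 (1980), Ch. III §5 Cor. 5.12–5.14
  («`card(T_h ∩ ⊕ O_i^×∖N(I_i)) = Σ_B h(B) ∏_p m_p(B)`»). [cite: VignerasLNM800, Ch. III §5 Cor. 5.12–5.14]
* S. Kudla, M. Rapoport, T. Yang, *Modular Forms and Special Cycles on Shimura Curves* (2006), §3.4 (3.4.4)–(3.4.6)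
  and (3.4.13) («`deg Z(t) = 2δ(d; D(B)) H₀(t; D(B))`, `H₀ = Σ_{c∣n} h(c²d)/w(c²d)`»). [cite: KudlaRapoportYang2006, §3.4 (3.4.4)–(3.4.6), (3.4.13)]
* D. A. Cox, *Primes of the form x² + ny²*, 2nd ed. (2013), §7.A (7.2)–(7.3), Thm. 7.24. [cite: Cox2013, §7.A]

## Scope (honest)

Theorems only — no definition, no named fact, no instance. The Kronecker symbols are Mathlib's `ZMod.χ₈` (at `2`, on
the class of the discriminant mod `8`) and `legendreSym 3` (at `3`), as in `…XSixSpecialCyclesEichlerClassNumbers`; the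
identification of `F`, `d_K` with the conductor and discriminant of Mathlib's ring of integers of `ℚ(√−t)` is not made.
-/

set_option maxSynthPendingDepth 3

open Quaternion Function
open scoped Pointwise
open Literature.NumberTheory.Automorphic Literature.NumberTheory.Automorphic.Brandt
open Literature.NumberTheory.Automorphic.HeckeTraceFormulaGL2Level (ellipticConductors)
open Literature.NumberTheory.QuadraticFields.Quadratic (BinQF.classNumber)

namespace Literature.Geometry.Kaehler.ComplexTorus.QuaternionType

/-! ## §1 `|L(t)/O₆^×| = Σ_{f} h(B_f)·m₂(B_f)·m₃(B_f)` -/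

section SumConductors

/-- Counting a finite type along a map into a finset. [folklore] -/
private theorem natCard_eq_sum_fiber₆₆ {T : Type*} [Finite T] {ι : Type*} [DecidableEq ι] (s : Finset ι)
    (g : T → ι) (hg : ∀ q, g q ∈ s) : Nat.card T = ∑ i ∈ s, Nat.card {q : T // g q = i} := by
  classical
  haveI := Fintype.ofFinite T
  rw [Nat.card_eq_fintype_card, ← Finset.card_univ,
    Finset.card_eq_sum_card_fiberwise (s := Finset.univ) (t := s) (f := g) fun q _ => hg q]
  refine Finset.sum_congr rfl fun i _ => ?_
  rw [Nat.card_eq_fintype_card, Fintype.card_subtype]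

/-- **The classes of ideals through `γ` split along their optimal orders `B_f`, `f ∈ ellipticConductors t n`**:
`#(ThroughClass O₆ γ) = Σ_f #{[J] : O_L(J) ∩ ℚ(γ) = B_f}` (for `ThroughClass O₆ γ` finite). [cite: VignerasLNM800, Ch. III §5 Cor. 5.14] -/
theorem card_throughClass_eq_sum_card_ordOf {γ : ℍ[ℚ,((-1 : ℤ) : ℚ),((3 : ℤ) : ℚ)]} {t : ℤ} {n : ℕ} (Hg : GammaHyp γ t n)
    [Finite (ThroughClass (Submodule.span ℤ (Set.range ![(⟨1/2, 1/2, 1/2, -1/2⟩ : ℍ[ℚ,((-1 : ℤ) : ℚ),((3 : ℤ) : ℚ)]), ⟨0, 1, 0, 0⟩, ⟨0, 0, 1, 0⟩, ⟨0, 0, 0, 1⟩])) γ)] :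
    Nat.card (ThroughClass (Submodule.span ℤ (Set.range ![(⟨1/2, 1/2, 1/2, -1/2⟩ : ℍ[ℚ,((-1 : ℤ) : ℚ),((3 : ℤ) : ℚ)]), ⟨0, 1, 0, 0⟩, ⟨0, 0, 1, 0⟩, ⟨0, 0, 0, 1⟩])) γ) =
      ∑ f ∈ ellipticConductors t n, Nat.card {q : ThroughClass (Submodule.span ℤ (Set.range ![(⟨1/2, 1/2, 1/2, -1/2⟩ : ℍ[ℚ,((-1 : ℤ) : ℚ),((3 : ℤ) : ℚ)]), ⟨0, 1, 0, 0⟩, ⟨0, 0, 1, 0⟩, ⟨0, 0, 0, 1⟩])) γ // optimalOrder q.rep γ = ordOf γ t n f} := by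
  classical
  haveI := isQuaternionAlgebra_neg_one_three
  haveI : IsAddTorsionFree ℍ[ℚ,((-1 : ℤ) : ℚ),((3 : ℤ) : ℚ)] := isAddTorsionFree_of_charZero_module ℚ ℍ[ℚ,((-1 : ℤ) : ℚ),((3 : ℤ) : ℚ)]
  have hmem : ∀ q : ThroughClass (Submodule.span ℤ (Set.range ![(⟨1/2, 1/2, 1/2, -1/2⟩ : ℍ[ℚ,((-1 : ℤ) : ℚ),((3 : ℤ) : ℚ)]), ⟨0, 1, 0, 0⟩, ⟨0, 0, 1, 0⟩, ⟨0, 0, 0, 1⟩])) γ,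
      optimalOrder q.rep γ ∈ (ellipticConductors t n).image (ordOf γ t n) := by
    intro q
    obtain ⟨f, hf, h⟩ := Hg.exists_eq_ordOf (isQuadOrder_optimalOrder q.rep_mem.1.1 q.rep_mem.2)
    exact Finset.mem_image.mpr ⟨f, hf, h.symm⟩
  rw [natCard_eq_sum_fiber₆₆ _ _ hmem, Finset.sum_image fun f hf g hg hfg => Hg.ordOf_injective hf hg hfg]

/-- **`|L(t)/O₆^×| = Σ_{f ∈ ellipticConductors 0 t} h(t_f² − 4n_f) · m₂(B_f) · m₃(B_f)` for every `t > 0`** —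
Eichler's class-number formula for the number of `O₆^×`-classes of special vectors of norm `t` (the index set of
KRY (3.4.13)), summed over the orders `B_f ⊇ ℤ[√−t]` of `ℚ(√−t)`; when `ℚ(√−t)` does not embed in `B` both
sides vanish. [cite: VignerasLNM800, Ch. III §5 Cor. 5.12–5.14] [cite: Eichler1955, Satz 5] [cite: KudlaRapoportYang2006, §3.4 (3.4.6) and (3.4.13)] -/
theorem card_unit_classes_eq_sum_conductors {m : ℕ} (hm : 0 < m) :
    (Nat.card (Quot (fun x y : {x : ℤ × ℤ × ℤ // x.1 ^ 2 - 3 * x.2.1 ^ 2 - 3 * x.2.2 ^ 2 = (m : ℤ)} ↦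
      ∃ v : ℍ[ℚ,((-1 : ℤ) : ℚ),((3 : ℤ) : ℚ)], (v ∈ order (-1) 3 ∨ v - ⟨1/2, 1/2, 1/2, -1/2⟩ ∈ order (-1) 3) ∧
        ((v * star v).re = 1 ∨ (v * star v).re = -1) ∧
        v * ⟨0, x.1.1, x.1.2.1, x.1.2.2⟩ = ⟨0, y.1.1, y.1.2.1, y.1.2.2⟩ * v)) : ℚ) =
      ∑ f ∈ ellipticConductors 0 m,
        (BinQF.classNumber (tOf 0 m f ^ 2 - 4 * nOf 0 m f) : ℚ) * (brFactorRam 2 0 m f * brFactorRam 3 0 m f) := by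
  classical
  haveI := isQuaternionAlgebra_neg_one_three
  by_cases hex : ∃ γ : ℍ[ℚ,((-1 : ℤ) : ℚ),((3 : ℤ) : ℚ)], γ.re = 0 ∧ (γ * star γ).re = m
  · obtain ⟨γ, hγ0, hγm⟩ := hex
    have hγne : γ ≠ 0 := by
      rintro rfl
      simp only [zero_mul, QuaternionAlgebra.re_zero] at hγm
      exact hm.ne' (by exact_mod_cast hγm.symm)
    have hγ : γ ∉ (⊥ : Subalgebra ℚ ℍ[ℚ,((-1 : ℤ) : ℚ),((3 : ℤ) : ℚ)]) := not_mem_bot_of_re_eq_zero hγ0 hγne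
    have hγm' : (γ * star γ).re = ((m : ℕ) : ℤ) := by rw [hγm, Int.cast_natCast]
    have Hg : GammaHyp γ 0 m := gammaHyp_of_pure hγ0 hm hγm
    have hT : Nat.card (Quot (fun x y : {x : ℤ × ℤ × ℤ // x.1 ^ 2 - 3 * x.2.1 ^ 2 - 3 * x.2.2 ^ 2 = (m : ℤ)} ↦
      ∃ v : ℍ[ℚ,((-1 : ℤ) : ℚ),((3 : ℤ) : ℚ)], (v ∈ order (-1) 3 ∨ v - ⟨1/2, 1/2, 1/2, -1/2⟩ ∈ order (-1) 3) ∧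
        ((v * star v).re = 1 ∨ (v * star v).re = -1) ∧
        v * ⟨0, x.1.1, x.1.2.1, x.1.2.2⟩ = ⟨0, y.1.1, y.1.2.1, y.1.2.2⟩ * v)) = Nat.card (ThroughClass (Submodule.span ℤ (Set.range ![(⟨1/2, 1/2, 1/2, -1/2⟩ : ℍ[ℚ,((-1 : ℤ) : ℚ),((3 : ℤ) : ℚ)]), ⟨0, 1, 0, 0⟩, ⟨0, 0, 1, 0⟩, ⟨0, 0, 0, 1⟩])) γ) :=
      (card_throughClass_eq_card_unit_classes hγ hγ0 hγm').symm
    -- `ThroughClass O₆ γ` is finite: empty if `L(m) = ∅`, else of positive cardinality `|L(m)/O₆^×|`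
    haveI : Finite (ThroughClass (Submodule.span ℤ (Set.range ![(⟨1/2, 1/2, 1/2, -1/2⟩ : ℍ[ℚ,((-1 : ℤ) : ℚ),((3 : ℤ) : ℚ)]), ⟨0, 1, 0, 0⟩, ⟨0, 0, 1, 0⟩, ⟨0, 0, 0, 1⟩])) γ) := by
      by_cases hV : Nonempty {x : ℤ × ℤ × ℤ // x.1 ^ 2 - 3 * x.2.1 ^ 2 - 3 * x.2.2 ^ 2 = (m : ℤ)}
      · haveI := finite_unit_classes (by exact_mod_cast hm : (0 : ℤ) < m)
        have hpos : Nat.card (Quot (fun x y : {x : ℤ × ℤ × ℤ // x.1 ^ 2 - 3 * x.2.1 ^ 2 - 3 * x.2.2 ^ 2 = (m : ℤ)} ↦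
      ∃ v : ℍ[ℚ,((-1 : ℤ) : ℚ),((3 : ℤ) : ℚ)], (v ∈ order (-1) 3 ∨ v - ⟨1/2, 1/2, 1/2, -1/2⟩ ∈ order (-1) 3) ∧
        ((v * star v).re = 1 ∨ (v * star v).re = -1) ∧
        v * ⟨0, x.1.1, x.1.2.1, x.1.2.2⟩ = ⟨0, y.1.1, y.1.2.1, y.1.2.2⟩ * v)) ≠ 0 :=
          Nat.card_ne_zero.mpr ⟨⟨Quot.mk _ hV.some⟩, inferInstance⟩
        exact Nat.finite_of_card_ne_zero (hT ▸ hpos)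
      · haveI : IsEmpty (ThroughClass (Submodule.span ℤ (Set.range ![(⟨1/2, 1/2, 1/2, -1/2⟩ : ℍ[ℚ,((-1 : ℤ) : ℚ),((3 : ℤ) : ℚ)]), ⟨0, 1, 0, 0⟩, ⟨0, 0, 1, 0⟩, ⟨0, 0, 0, 1⟩])) γ) := ⟨fun q => by
          obtain ⟨y, -⟩ := exists_pureVec_psi_eq hγ hγ0 hγm' q
          exact hV ⟨y⟩⟩
        infer_instance
    rw [hT, card_throughClass_eq_sum_card_ordOf Hg, Nat.cast_sum]
    exact Finset.sum_congr rfl fun f hf => card_throughClass_ordOf_eq_classNumber_mul_brFactorRam Hg hf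
  · -- no pure element of norm `m`
    have hE : IsEmpty (Quot (fun x y : {x : ℤ × ℤ × ℤ // x.1 ^ 2 - 3 * x.2.1 ^ 2 - 3 * x.2.2 ^ 2 = (m : ℤ)} ↦
      ∃ v : ℍ[ℚ,((-1 : ℤ) : ℚ),((3 : ℤ) : ℚ)], (v ∈ order (-1) 3 ∨ v - ⟨1/2, 1/2, 1/2, -1/2⟩ ∈ order (-1) 3) ∧
        ((v * star v).re = 1 ∨ (v * star v).re = -1) ∧
        v * ⟨0, x.1.1, x.1.2.1, x.1.2.2⟩ = ⟨0, y.1.1, y.1.2.1, y.1.2.2⟩ * v)) := by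
      refine ⟨fun q => Quot.inductionOn q fun y => hex ⟨⟨0, y.1.1, y.1.2.1, y.1.2.2⟩, rfl, ?_⟩⟩
      rw [re_mul_star_eq_coords]
      have h' : ((y.1.1 : ℤ) : ℚ) ^ 2 - 3 * ((y.1.2.1 : ℤ) : ℚ) ^ 2 - 3 * ((y.1.2.2 : ℤ) : ℚ) ^ 2 = ((m : ℤ) : ℚ) := by
        exact_mod_cast y.2
      show (0 : ℚ) ^ 2 + (y.1.1 : ℚ) ^ 2 - 3 * (y.1.2.1 : ℚ) ^ 2 - 3 * (y.1.2.2 : ℚ) ^ 2 = (m : ℕ)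
      rw [Int.cast_natCast] at h'
      linear_combination h'
    have hno : ∀ x : ℍ[ℚ,((-1 : ℤ) : ℚ),((3 : ℤ) : ℚ)], reducedTrace ℚ ℍ[ℚ,((-1 : ℤ) : ℚ),((3 : ℤ) : ℚ)] x = (0 : ℤ) → reducedNorm ℚ ℍ[ℚ,((-1 : ℤ) : ℚ),((3 : ℤ) : ℚ)] x ≠ m := by
      intro x hx hn
      rw [reducedTrace_eq_two_mul_re, Int.cast_zero] at hx
      rw [reducedNorm_eq_re_mul_star] at hn
      exact hex ⟨x, by linarith, hn⟩
    rw [Nat.card_of_isEmpty, Nat.cast_zero]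
    symm
    refine Finset.sum_eq_zero fun f hf => ?_
    rw [brFactorRam_two_mul_three_eq_zero_of_forall (by positivity) hno hf, mul_zero]

end SumConductors

/-! ## §2 KRY's shape: `|L(t)/O₆^×| = m₂(O_K)·m₃(O_K) · Σ_{c ∣ F, (c,6)=1} h(c²·d_K)` -/

section KRY

/-- **`F²·d_K = −4t`**: `F = conductor 0 t` is KRY's `n` and `d_K = t_F² − 4n_F = −d` in `4t = n²d`.
[cite: Cox2013, §7.A (7.3)] [cite: KudlaRapoportYang2006, §3.4 (before (3.4.4))] -/
theorem conductor_sq_mul_disc {m : ℕ} (hm : 0 < m) :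
    ((conductor 0 m : ℕ) : ℤ) ^ 2 * (tOf 0 m (conductor 0 m) ^ 2 - 4 * nOf 0 m (conductor 0 m)) = -4 * m := by
  have h := sq_mul_disc (t := 0) (n := m) (by positivity) (conductor_mem (by positivity))
  rw [h]; ring

/-- `disc B_f = (F/f)²·d_K`. [cite: Cox2013, §7.A (7.3)] -/
theorem disc_ordOf_eq_sq_mul {m : ℕ} (hm : 0 < m) {f : ℕ} (hf : f ∈ ellipticConductors 0 m) :
    tOf 0 m f ^ 2 - 4 * nOf 0 m f =
      ((conductor 0 m / f : ℕ) : ℤ) ^ 2 * (tOf 0 m (conductor 0 m) ^ 2 - 4 * nOf 0 m (conductor 0 m)) := by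
  have h0 : (0 : ℤ) ^ 2 < 4 * m := by positivity
  have hf0 : 0 < f := pos_of_mem_ellipticConductors h0 hf
  obtain ⟨c, hc⟩ : f ∣ conductor 0 m := dvd_conductor hf
  have h1 := sq_mul_disc h0 hf
  have h2 := sq_mul_disc h0 (conductor_mem h0)
  rw [hc, Nat.mul_div_cancel_left _ hf0]
  rw [hc] at h2
  push_cast at h1 h2
  have hfZ : ((f : ℤ)) ^ 2 ≠ 0 := pow_ne_zero 2 (by exact_mod_cast hf0.ne')
  apply mul_left_cancel₀ hfZ
  rw [h1, ← h2]; ring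

/-- `m_p(B_f) = [p ∤ F/f] · m_p(O_K)` for `p ∣ 6`: `B_f` is maximal at `p` iff `p ∤ F/f`, and then
`ρ_p(t_f, n_f) = ρ_p(t_F, n_F)`. [cite: VignerasLNM800, Ch. II §3] [cite: Cox2013, §7.A, §7.D Prop. 7.20] -/
theorem brFactorRam_eq_of_mem {m : ℕ} (hm : 0 < m) {p : ℕ} (hp : p.Prime) {f : ℕ} (hf : f ∈ ellipticConductors 0 m) :
    brFactorRam p 0 m f =
      if p ∣ conductor 0 m / f then 0 else brFactorRam p 0 m (conductor 0 m) := by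
  have h0 : (0 : ℤ) ^ 2 < 4 * m := by positivity
  have hf0 : 0 < f := pos_of_mem_ellipticConductors h0 hf
  have hF := conductor_mem h0
  have hF0 := conductor_pos h0
  obtain ⟨c, hc⟩ : f ∣ conductor 0 m := dvd_conductor hf
  have hcdef : conductor 0 m / f = c := by rw [hc, Nat.mul_div_cancel_left _ hf0]
  rw [hcdef]
  -- `F·p` is never a conductor
  have hFp : conductor 0 m * p ∉ ellipticConductors 0 m := by
    intro h
    have hd := dvd_conductor h
    have : conductor 0 m * p ≤ conductor 0 m := Nat.le_of_dvd hF0 hd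
    have : conductor 0 m * 2 ≤ conductor 0 m * p := Nat.mul_le_mul_left _ hp.two_le
    omega
  -- `f·p` is a conductor iff `p ∣ c`
  have hfp : f * p ∈ ellipticConductors 0 m ↔ p ∣ c := by
    rw [mem_ellipticConductors_iff_dvd h0, hc]
    exact Nat.mul_dvd_mul_iff_left hf0
  unfold brFactorRam
  rw [if_neg hFp]
  by_cases hpc : p ∣ c
  · rw [if_pos (hfp.mpr hpc), if_pos hpc]
  · rw [if_neg (mt hfp.mp hpc), if_neg hpc,
      rho_tOf_eq_of_dvd h0 hp hF (dvd_conductor hf) (by rwa [hcdef])]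

/-- `(c, 6) = 1 ⟺ 2 ∤ c ∧ 3 ∤ c`. [folklore] -/
private theorem coprime_six_iff₆₆ (c : ℕ) : c.Coprime 6 ↔ ¬ 2 ∣ c ∧ ¬ 3 ∣ c := by
  rw [show (6 : ℕ) = 2 * 3 from rfl, Nat.coprime_mul_iff_right, Nat.coprime_comm,
    Nat.Prime.coprime_iff_not_dvd Nat.prime_two, Nat.coprime_comm, Nat.Prime.coprime_iff_not_dvd Nat.prime_three]

/-- **Eichler's class-number formula in KRY's shape**: for every `t > 0`, with `F = conductor 0 t` (so `4t = F²·d`,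
`d = −d_K = −(t_F² − 4n_F)` the absolute fundamental discriminant of `ℚ(√−t)`),
`|L(t)/O₆^×| = m₂(O_K)·m₃(O_K) · Σ_{c ∣ F, (c, 6) = 1} h(c²·d_K)`, `m_p(O_K) = brFactorRam p 0 t F = 2 − ρ_p(t_F, n_F)`
(`= 1 − χ_d(p)`, KRY's `δ(d; 6) = ∏_{p ∣ 6} (1 − χ_d(p))`). [cite: KudlaRapoportYang2006, §3.4 (3.4.4)–(3.4.6) and (3.4.13)] [cite: VignerasLNM800, Ch. III §5 Cor. 5.12–5.14] [cite: Eichler1955, Satz 5] -/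
theorem card_unit_classes_eq_delta_mul_sum_classNumber {m : ℕ} (hm : 0 < m) :
    (Nat.card (Quot (fun x y : {x : ℤ × ℤ × ℤ // x.1 ^ 2 - 3 * x.2.1 ^ 2 - 3 * x.2.2 ^ 2 = (m : ℤ)} ↦
      ∃ v : ℍ[ℚ,((-1 : ℤ) : ℚ),((3 : ℤ) : ℚ)], (v ∈ order (-1) 3 ∨ v - ⟨1/2, 1/2, 1/2, -1/2⟩ ∈ order (-1) 3) ∧
        ((v * star v).re = 1 ∨ (v * star v).re = -1) ∧
        v * ⟨0, x.1.1, x.1.2.1, x.1.2.2⟩ = ⟨0, y.1.1, y.1.2.1, y.1.2.2⟩ * v)) : ℚ) =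
      (brFactorRam 2 0 m (conductor 0 m) * brFactorRam 3 0 m (conductor 0 m)) *
        ∑ c ∈ (conductor 0 m).divisors with c.Coprime 6,
          (BinQF.classNumber (((c : ℕ) : ℤ) ^ 2 *
            (tOf 0 m (conductor 0 m) ^ 2 - 4 * nOf 0 m (conductor 0 m))) : ℚ) := by
  have h0 : (0 : ℤ) ^ 2 < 4 * m := by positivity
  rw [card_unit_classes_eq_sum_conductors hm, ellipticConductors_eq_divisors h0, Finset.sum_filter, Finset.mul_sum,
    ← Nat.sum_div_divisors (conductor 0 m)]
  -- the left sum is now over `g = F/c`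
  refine Finset.sum_congr rfl fun c hc => ?_
  have hcF : c ∣ conductor 0 m := Nat.dvd_of_mem_divisors hc
  have hg' : conductor 0 m / c ∈ ellipticConductors 0 m := by
    rw [ellipticConductors_eq_divisors h0]
    exact Nat.mem_divisors.mpr ⟨Nat.div_dvd_of_dvd hcF, (conductor_pos h0).ne'⟩
  have hFg : conductor 0 m / (conductor 0 m / c) = c := Nat.div_div_self hcF (conductor_pos h0).ne'
  rw [disc_ordOf_eq_sq_mul hm hg', brFactorRam_eq_of_mem hm Nat.prime_two hg',
    brFactorRam_eq_of_mem hm Nat.prime_three hg', hFg]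
  by_cases h2 : 2 ∣ c
  · rw [if_pos h2, if_neg (fun h => ((coprime_six_iff₆₆ c).mp h).1 h2)]; ring
  by_cases h3 : 3 ∣ c
  · rw [if_pos h3, if_neg (fun h => ((coprime_six_iff₆₆ c).mp h).2 h3)]; ring
  rw [if_neg h2, if_neg h3, if_pos ((coprime_six_iff₆₆ c).mpr ⟨h2, h3⟩)]; ring

end KRY

/-! ## §3 The dictionary `m_p(O_K) = 1 − χ_{d_K}(p)`: `ρ₂ = 1 + χ₈(D)`, `ρ₃ = 1 + (D/3)` -/

section Kronecker

/-- **`ρ₃(t, n) = 1 + (t² − 4n ∕ 3)`**: the number of roots of `x² − tx + n` modulo `3` is `1 +` the Legendre symbol of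
its discriminant (brute force over `ℤ/3`). [cite: Cox2013, §7.D (Legendre symbol and splitting of primes in orders)] -/
theorem rho_three_eq_one_add_legendreSym (t n : ℤ) : (Brandt.rho 3 t n : ℤ) = 1 + legendreSym 3 (t ^ 2 - 4 * n) := by
  rw [rho_eq_card_zmod, legendreSym]
  push_cast
  generalize (t : ZMod 3) = a
  generalize (n : ZMod 3) = b
  revert a b
  decide

/-- **`ρ₂(t, n) = 1 + χ₈(t² − 4n)`**: the number of roots of `x² − tx + n` modulo `2` is `1 +` the Kronecker symbol
`(t² − 4n ∕ 2)` (`χ₈`: `0` on even classes, `1` on `±1`, `−1` on `±3 (mod 8)`; brute force over `ℤ/8`).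
[cite: Cox2013, §7.D (the Kronecker symbol at 2)] -/
theorem rho_two_eq_one_add_χ₈ (t n : ℤ) :
    (Brandt.rho 2 t n : ℤ) = 1 + ZMod.χ₈ (((t ^ 2 - 4 * n : ℤ)) : ZMod 8) := by
  rw [rho_eq_card_zmod,
    show ((t : ℤ) : ZMod 2) = ZMod.castHom (show 2 ∣ 8 by norm_num) (ZMod 2) ((t : ℤ) : ZMod 8) from
      (map_intCast _ t).symm,
    show ((n : ℤ) : ZMod 2) = ZMod.castHom (show 2 ∣ 8 by norm_num) (ZMod 2) ((n : ℤ) : ZMod 8) from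
      (map_intCast _ n).symm]
  push_cast
  generalize (t : ZMod 8) = a
  generalize (n : ZMod 8) = b
  revert a b
  decide

/-- `F·p` is not a conductor (`F` is the largest one). [folklore] -/
private theorem conductor_mul_not_mem₆₆ {m : ℕ} (hm : 0 < m) {p : ℕ} (hp : p.Prime) :
    conductor 0 m * p ∉ ellipticConductors 0 m := by
  have h0 : (0 : ℤ) ^ 2 < 4 * m := by positivity
  have hF0 := conductor_pos h0
  intro h
  have h1 : conductor 0 m * p ≤ conductor 0 m := Nat.le_of_dvd hF0 (dvd_conductor h)
  have h2 : conductor 0 m * 2 ≤ conductor 0 m * p := Nat.mul_le_mul_left _ hp.two_le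
  omega

/-- **`m₂(O_K) = 1 − χ₈(d_K)`** (`= 1 − χ_d(2)`, the Kronecker symbol of the fundamental discriminant at `2`).
[cite: VignerasLNM800, Ch. II §3 («`m_p = 1 − (L∕p)`»)] [cite: KudlaRapoportYang2006, §3.4 (3.4.6)] -/
theorem brFactorRam_two_conductor {m : ℕ} (hm : 0 < m) :
    brFactorRam 2 0 m (conductor 0 m) =
      ((1 - ZMod.χ₈ (((tOf 0 m (conductor 0 m) ^ 2 - 4 * nOf 0 m (conductor 0 m) : ℤ)) : ZMod 8) : ℤ) : ℚ) := by
  rw [brFactorRam, if_neg (conductor_mul_not_mem₆₆ hm Nat.prime_two),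
    show ((Brandt.rho 2 (tOf 0 m (conductor 0 m)) (nOf 0 m (conductor 0 m)) : ℕ) : ℚ) =
      (((Brandt.rho 2 (tOf 0 m (conductor 0 m)) (nOf 0 m (conductor 0 m)) : ℕ) : ℤ) : ℚ) from
      (Int.cast_natCast _).symm,
    rho_two_eq_one_add_χ₈]
  push_cast; ring

/-- **`m₃(O_K) = 1 − (d_K ∕ 3)`** (`= 1 − χ_d(3)`). [cite: VignerasLNM800, Ch. II §3 («`m_p = 1 − (L∕p)`»)] [cite: KudlaRapoportYang2006, §3.4 (3.4.6)] -/
theorem brFactorRam_three_conductor {m : ℕ} (hm : 0 < m) :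
    brFactorRam 3 0 m (conductor 0 m) =
      ((1 - legendreSym 3 (tOf 0 m (conductor 0 m) ^ 2 - 4 * nOf 0 m (conductor 0 m)) : ℤ) : ℚ) := by
  rw [brFactorRam, if_neg (conductor_mul_not_mem₆₆ hm Nat.prime_three),
    show ((Brandt.rho 3 (tOf 0 m (conductor 0 m)) (nOf 0 m (conductor 0 m)) : ℕ) : ℚ) =
      (((Brandt.rho 3 (tOf 0 m (conductor 0 m)) (nOf 0 m (conductor 0 m)) : ℕ) : ℤ) : ℚ) from
      (Int.cast_natCast _).symm,
    rho_three_eq_one_add_legendreSym]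
  push_cast; ring

/-- **EICHLER'S CLASS-NUMBER FORMULA FOR THE SPECIAL CYCLES OF `X₆`, KRY's form, all `t`**: for every `t > 0`, with
`F = conductor 0 t`, `d_K = t_F² − 4n_F` (`4t = F²·(−d_K)`, `−d_K` KRY's `d`),
`|L(t)/O₆^×| = (1 − χ₈(d_K)) · (1 − (d_K∕3)) · Σ_{c ∣ F, (c, 6) = 1} h(c²·d_K)` — `δ(d; 6)·Σ_{c ∣ n, (c,6)=1} h(c²d)` of
KRY (3.4.4)–(3.4.6) for the index set (3.4.13), the general statement behind the twelve tabulated identities of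
`…XSixSpecialCyclesEichlerClassNumbers`. [cite: KudlaRapoportYang2006, §3.4 (3.4.4)–(3.4.6) and (3.4.13)] [cite: VignerasLNM800, Ch. III §5 Cor. 5.12–5.14; Ch. II §3] [cite: Eichler1955, Satz 5] -/
theorem card_unit_classes_eq_kronecker_mul_sum_classNumber {m : ℕ} (hm : 0 < m) :
    (Nat.card (Quot (fun x y : {x : ℤ × ℤ × ℤ // x.1 ^ 2 - 3 * x.2.1 ^ 2 - 3 * x.2.2 ^ 2 = (m : ℤ)} ↦
      ∃ v : ℍ[ℚ,((-1 : ℤ) : ℚ),((3 : ℤ) : ℚ)], (v ∈ order (-1) 3 ∨ v - ⟨1/2, 1/2, 1/2, -1/2⟩ ∈ order (-1) 3) ∧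
        ((v * star v).re = 1 ∨ (v * star v).re = -1) ∧
        v * ⟨0, x.1.1, x.1.2.1, x.1.2.2⟩ = ⟨0, y.1.1, y.1.2.1, y.1.2.2⟩ * v)) : ℤ) =
      (1 - ZMod.χ₈ (((tOf 0 m (conductor 0 m) ^ 2 - 4 * nOf 0 m (conductor 0 m) : ℤ)) : ZMod 8)) *
        (1 - legendreSym 3 (tOf 0 m (conductor 0 m) ^ 2 - 4 * nOf 0 m (conductor 0 m))) *
        ∑ c ∈ (conductor 0 m).divisors with c.Coprime 6,
          (BinQF.classNumber (((c : ℕ) : ℤ) ^ 2 *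
            (tOf 0 m (conductor 0 m) ^ 2 - 4 * nOf 0 m (conductor 0 m))) : ℤ) := by
  have h := card_unit_classes_eq_delta_mul_sum_classNumber hm
  rw [brFactorRam_two_conductor hm, brFactorRam_three_conductor hm] at h
  exact_mod_cast h

end Kronecker

/-! ## §4 The primitive count in closed form: `P(m) = h(D_m)·[4 ∤ m](1 − χ₈(D_m))·[9 ∤ m](1 − (D_m∕3))` -/

section PrimitiveClosedForm

/-- `S_m = B_{f₁}` is maximal at `2` iff `4 ∤ m` (`f₁·2` is a conductor iff `4 ∣ m`). [cite: Cox2013, §7.A (7.2)–(7.3)] -/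
theorem f₁_mul_two_mem_ellipticConductors_iff {m : ℕ} (hm : 0 < m) :
    (if (m : ℤ) % 4 = 3 then 2 else 1) * 2 ∈ ellipticConductors 0 m ↔ 4 ∣ m := by
  have h0 : (0 : ℤ) ^ 2 < 4 * m := by positivity
  split_ifs with h3
  · rw [mem_ellipticConductors_iff h0]; norm_num; omega
  · rw [mem_ellipticConductors_iff h0]; norm_num; omega

/-- `S_m = B_{f₁}` is maximal at `3` iff `9 ∤ m` (`f₁·3` is a conductor iff `9 ∣ m`). [cite: Cox2013, §7.A (7.2)–(7.3)] -/
theorem f₁_mul_three_mem_ellipticConductors_iff {m : ℕ} (hm : 0 < m) :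
    (if (m : ℤ) % 4 = 3 then 2 else 1) * 3 ∈ ellipticConductors 0 m ↔ 9 ∣ m := by
  have h0 : (0 : ℤ) ^ 2 < 4 * m := by positivity
  split_ifs with h3
  · rw [mem_ellipticConductors_iff h0]; norm_num; omega
  · rw [mem_ellipticConductors_iff h0]; norm_num; omega

/-- `disc S_m = D_m`: `−m` if `m ≡ 3 (mod 4)`, `−4m` otherwise. [cite: Cox2013, §7.A (7.3)] -/
theorem disc_f₁ {m : ℕ} (hm : 0 < m) :
    tOf 0 m (if (m : ℤ) % 4 = 3 then 2 else 1) ^ 2 - 4 * nOf 0 m (if (m : ℤ) % 4 = 3 then 2 else 1) = if (m : ℤ) % 4 = 3 then -(m : ℤ) else -4 * m := by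
  rw [← disc_div_sq (by positivity) (f₁_mem_ellipticConductors hm)]
  split_ifs with h3
  · push_cast; omega
  · push_cast; omega

/-- **`P(m) = h(D_m) · [4 ∤ m]·(1 − χ₈(D_m)) · [9 ∤ m]·(1 − (D_m∕3))` for EVERY `m > 0`**, `D_m = disc S_m` (`−m` if
`m ≡ 3 (mod 4)`, else `−4m`): the number of `O₆^×`-classes of PRIMITIVE special vectors of norm `m` in closed form —
class number of the order `S_m ⊇ ℤ[√−m]` optimally embedded, times Eichler's local factors `m_p(S_m)` at the ramified
primes `2, 3` (`0` unless `S_m` is maximal at `p`, then `1 − χ(p)`). [cite: Eichler1955, Satz 5] [cite: VignerasLNM800, Ch. III §5 Thm. 5.11, Cor. 5.12; Ch. II §3] [cite: KudlaRapoportYang2006, §3.4 (3.4.6) and Remark 3.4.7] -/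
theorem card_primitive_classes_closed_form {m : ℕ} (hm : 0 < m) :
    (Nat.card (Quot (fun x y : {x : ℤ × ℤ × ℤ // x.1 ^ 2 - 3 * x.2.1 ^ 2 - 3 * x.2.2 ^ 2 = (m : ℤ) ∧
      ∃ u : ℤ × ℤ × ℤ, u.1 * x.1 + u.2.1 * x.2.1 + u.2.2 * x.2.2 = 1} ↦
      ∃ v : ℍ[ℚ,((-1 : ℤ) : ℚ),((3 : ℤ) : ℚ)], (v ∈ order (-1) 3 ∨ v - ⟨1/2, 1/2, 1/2, -1/2⟩ ∈ order (-1) 3) ∧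
        ((v * star v).re = 1 ∨ (v * star v).re = -1) ∧
        v * ⟨0, x.1.1, x.1.2.1, x.1.2.2⟩ = ⟨0, y.1.1, y.1.2.1, y.1.2.2⟩ * v)) : ℤ) =
      BinQF.classNumber (if (m : ℤ) % 4 = 3 then -(m : ℤ) else -4 * m) *
        ((if 4 ∣ m then 0 else
            1 - ZMod.χ₈ (((if (m : ℤ) % 4 = 3 then -(m : ℤ) else -4 * m : ℤ)) : ZMod 8)) *
          (if 9 ∣ m then 0 else 1 - legendreSym 3 (if (m : ℤ) % 4 = 3 then -(m : ℤ) else -4 * m))) := by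
  have h := card_primitive_classes_eq_classNumber_disc_mul_brFactorRam hm
  have e2 : brFactorRam 2 0 m (if (m : ℤ) % 4 = 3 then 2 else 1) = ((if 4 ∣ m then 0 else
      1 - ZMod.χ₈ (((if (m : ℤ) % 4 = 3 then -(m : ℤ) else -4 * m : ℤ)) : ZMod 8) : ℤ) : ℚ) := by
    rw [brFactorRam]
    by_cases h4 : 4 ∣ m
    · rw [if_pos ((f₁_mul_two_mem_ellipticConductors_iff hm).mpr h4), if_pos h4, Int.cast_zero]
    · rw [if_neg (mt (f₁_mul_two_mem_ellipticConductors_iff hm).mp h4), if_neg h4,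
        show ((Brandt.rho 2 (tOf 0 m (if (m : ℤ) % 4 = 3 then 2 else 1)) (nOf 0 m (if (m : ℤ) % 4 = 3 then 2 else 1)) : ℕ) : ℚ) =
          (((Brandt.rho 2 (tOf 0 m (if (m : ℤ) % 4 = 3 then 2 else 1)) (nOf 0 m (if (m : ℤ) % 4 = 3 then 2 else 1)) : ℕ) : ℤ) : ℚ) from (Int.cast_natCast _).symm,
        rho_two_eq_one_add_χ₈, disc_f₁ hm]
      push_cast; ring
  have e3 : brFactorRam 3 0 m (if (m : ℤ) % 4 = 3 then 2 else 1) = ((if 9 ∣ m then 0 else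
      1 - legendreSym 3 (if (m : ℤ) % 4 = 3 then -(m : ℤ) else -4 * m) : ℤ) : ℚ) := by
    rw [brFactorRam]
    by_cases h9 : 9 ∣ m
    · rw [if_pos ((f₁_mul_three_mem_ellipticConductors_iff hm).mpr h9), if_pos h9, Int.cast_zero]
    · rw [if_neg (mt (f₁_mul_three_mem_ellipticConductors_iff hm).mp h9), if_neg h9,
        show ((Brandt.rho 3 (tOf 0 m (if (m : ℤ) % 4 = 3 then 2 else 1)) (nOf 0 m (if (m : ℤ) % 4 = 3 then 2 else 1)) : ℕ) : ℚ) =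
          (((Brandt.rho 3 (tOf 0 m (if (m : ℤ) % 4 = 3 then 2 else 1)) (nOf 0 m (if (m : ℤ) % 4 = 3 then 2 else 1)) : ℕ) : ℤ) : ℚ) from (Int.cast_natCast _).symm,
        rho_three_eq_one_add_legendreSym, disc_f₁ hm]
      push_cast; ring
  rw [e2, e3] at h
  exact_mod_cast h

/-- **The closed form reproduces the series' enumerated values** `P(1) = P(3) = 2`, `P(25) = P(75) = 4`, `P(100) = 0`
(`…XSixSpecialCyclesPrimitiveClassNumbers` §5, obtained there by exhaustion): `h(−4)·1·2`, `h(−3)·2·1`,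
`h(−100)·1·2 = 2·2`, `h(−75)·2·1 = 2·2`, and `4 ∣ 100`. [cite: KudlaRapoportYang2006, §3.4 (3.4.6)] [cite: Cox2013, Thm. 2.13 (h(D) by reduced forms)] -/
theorem closed_form_values :
    (BinQF.classNumber (-4) : ℤ) * ((1 - ZMod.χ₈ (((-4 : ℤ)) : ZMod 8)) * (1 - legendreSym 3 (-4))) = 2 ∧
    (BinQF.classNumber (-3) : ℤ) * ((1 - ZMod.χ₈ (((-3 : ℤ)) : ZMod 8)) * (1 - legendreSym 3 (-3))) = 2 ∧
    (BinQF.classNumber (-100) : ℤ) * ((1 - ZMod.χ₈ (((-100 : ℤ)) : ZMod 8)) * (1 - legendreSym 3 (-100))) = 4 ∧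
    (BinQF.classNumber (-75) : ℤ) * ((1 - ZMod.χ₈ (((-75 : ℤ)) : ZMod 8)) * (1 - legendreSym 3 (-75))) = 4 := by
  decide +kernel

/-- … and agrees with the series at `m = 1`: `P(1) = 2` re-derived from Eichler's side. [cite: KudlaRapoportYang2006, §3.4 (3.4.6)] -/
theorem card_primitive_one_via_eichler : (Nat.card (Quot (fun x y : {x : ℤ × ℤ × ℤ // x.1 ^ 2 - 3 * x.2.1 ^ 2 - 3 * x.2.2 ^ 2 = (1 : ℤ) ∧
      ∃ u : ℤ × ℤ × ℤ, u.1 * x.1 + u.2.1 * x.2.1 + u.2.2 * x.2.2 = 1} ↦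
      ∃ v : ℍ[ℚ,((-1 : ℤ) : ℚ),((3 : ℤ) : ℚ)], (v ∈ order (-1) 3 ∨ v - ⟨1/2, 1/2, 1/2, -1/2⟩ ∈ order (-1) 3) ∧
        ((v * star v).re = 1 ∨ (v * star v).re = -1) ∧
        v * ⟨0, x.1.1, x.1.2.1, x.1.2.2⟩ = ⟨0, y.1.1, y.1.2.1, y.1.2.2⟩ * v)) : ℤ) = 2 := by
  have h := card_primitive_classes_closed_form (m := 1) one_pos
  have e : (Nat.card (Quot (fun x y : {x : ℤ × ℤ × ℤ // x.1 ^ 2 - 3 * x.2.1 ^ 2 - 3 * x.2.2 ^ 2 = (1 : ℤ) ∧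
      ∃ u : ℤ × ℤ × ℤ, u.1 * x.1 + u.2.1 * x.2.1 + u.2.2 * x.2.2 = 1} ↦
      ∃ v : ℍ[ℚ,((-1 : ℤ) : ℚ),((3 : ℤ) : ℚ)], (v ∈ order (-1) 3 ∨ v - ⟨1/2, 1/2, 1/2, -1/2⟩ ∈ order (-1) 3) ∧
        ((v * star v).re = 1 ∨ (v * star v).re = -1) ∧
        v * ⟨0, x.1.1, x.1.2.1, x.1.2.2⟩ = ⟨0, y.1.1, y.1.2.1, y.1.2.2⟩ * v)) : ℤ) = Nat.card (Quot (fun x y : {x : ℤ × ℤ × ℤ // x.1 ^ 2 - 3 * x.2.1 ^ 2 - 3 * x.2.2 ^ 2 = ((1 : ℕ) : ℤ) ∧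
      ∃ u : ℤ × ℤ × ℤ, u.1 * x.1 + u.2.1 * x.2.1 + u.2.2 * x.2.2 = 1} ↦
      ∃ v : ℍ[ℚ,((-1 : ℤ) : ℚ),((3 : ℤ) : ℚ)], (v ∈ order (-1) 3 ∨ v - ⟨1/2, 1/2, 1/2, -1/2⟩ ∈ order (-1) 3) ∧
        ((v * star v).re = 1 ∨ (v * star v).re = -1) ∧
        v * ⟨0, x.1.1, x.1.2.1, x.1.2.2⟩ = ⟨0, y.1.1, y.1.2.1, y.1.2.2⟩ * v)) := rfl
  rw [e, h]
  decide +kernel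

end PrimitiveClosedForm

end Literature.Geometry.Kaehler.ComplexTorus.QuaternionType
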